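import Summits.BirchSwinnertonDyer.BirchSwinnertonDyer.Theorems.AlignedTransportAtTwoMainConjectureTransportAlignedAtTwoKilfordKernelLetterCrossLevelOnePrime
import Summits.BirchSwinnertonDyer.BirchSwinnertonDyer.Theorems.AlignedTransportAtTwoMainConjectureTransportAlignedAtTwoKilfordKernelLetterOfCarrierProp
import HarnessLib

/-!
# Crux C1 `MainConjectureTransportAlignedAtTwo` (stmt-BirchSwinnertonDyer-22296), line `birth`: `stub_lamLawKilford` SPLIT BY SHAPE — equal conductors (MULT2 +
# kernel-letter carrier), the ONE-PRIME unequal shapes `N(W₂) = q·N(W₁)` / `N(W₁) = q·N(W₂)` (the assembled cross-level capstone: Ihara + lifts + MULT2 +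
# the forms-widened carrier), every other unequal shape an inline hypothesis WITH the lifts in hand (width seat att-p4 g18; `--supports 22296`; the v29 split)

THEOREMS ONLY (no `def`, no `sorry`, no instance). CONDITIONAL; closes nothing; BSD is not proved by this.

att-p4 g16's `…OfPrintAndCopySplit.lamLawKilford_of_print_split` dispatches `stub_lamLawKilford` on `N(W₁) = N(W₂)`; THIS file refines the UNEQUAL branch by
SHAPE: if `N(W₂) = q·N(W₁)` or `N(W₁) = q·N(W₂)` for a prime `q` not dividing the smaller conductor, the depleted same-kernel statement is the THEOREM
`…KilfordKernelLetterCrossLevelOnePrime.uniformize_depleted_iff_of_onePrime_of_facts` (PRINT {Ihara `ihara_periodHomology_mod_eisenstein`, plus period unit} +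
`F1Sign2.MultiplicityTwoOnStratumAtTwo` + `hKLCF : ∀ N ι, ∃ Dj : ModularJacobianGaloisDataWithFormsAndPairing N ι, KernelLetterCarrierWithFormsAtTwo N ι Dj.to…` +
the two even-branch lifts, which ARE in scope where the stub is consumed); every other unequal shape is the inline hypothesis `hRest` = v27's `hCopyNe` with
THREE EXTRA BINDERS — the lifts `G₁, G₂` of `D₁.f, D₂.f` and the two shape exclusions — so that a future prover of the remaining shapes has the `μ = 0`
non-vanishing available (att-p4 g18 remark: the old inline stub had no `G`-binders).

* §1 `lamLawKilford_of_print_splitShape` — modulo {PRINT period unit, T1⁺, T4} + `hEq` + Ihara + MULT2 + `hKLCF` + `hRest` (proof = att-p4 g16's, with the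
  shape dispatch inserted where `hCopyNe` was invoked; the old line at level `N(W₂)` from att-p3 g18's `exists_oldLine` transported along the level equation).
* §2 `lamLawKilford_of_facts_splitShape` — T4 discharged (`exists_datum_odd_maninConstant`), `hEq` := `…OfCarrierProp.lamLawKilford_eq_of_multTwo_of_kernelLetterCarrierAtTwo`
  fed by `hKLCF` through -ty g15's glue `KernelLetterCarrier.kernelLetterCarrierAtTwo_of_withForms`: `stub_lamLawKilford` from PRINT⁴ {period unit, modularity, T1⁺,
  Ihara} + MULT2 + `hKLCF` + `hRest`.

References: [GreenbergVatsal2000, Thm. (1.4) and §3]; [DarmonDiamondTaylor1995, §1.5, §1.7, Lemma 4.28 (a)]; [KilfordWiese2008, Question 1.9]; [Wiese2007Multiplicities,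
Prop. 2.2, Cor. 4.2]; [KrausOesterle1992, Prop. 3]; [AtkinLehner1970, §3].
-/

noncomputable section

-- justification: the `Summit.BirchSwinnertonDyer.BirchSwinnertonDyer.…` path repeats a component (route-file convention)
set_option linter.dupNamespace false
set_option autoImplicit false

open scoped MatrixGroups ModularForm NumberField Classical
open CongruenceSubgroup Complex WeierstrassCurve IsDedekindDomain Polynomial Module
open Literature.NumberTheory.EllipticCurves Literature.NumberTheory.EllipticCurves.ModularForms
open Literature.NumberTheory.EllipticCurves.Greenberg1999 Literature.NumberTheory.EllipticCurves.GreenbergVatsal2000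
open Summit.BirchSwinnertonDyer.Rank1Residual.F1Sign2 Summit.BirchSwinnertonDyer.Rank1Residual.X1.MuLambda
open Summit.BirchSwinnertonDyer.BirchSwinnertonDyer.Theorems.AlignedTransportAtTwoClosure
open Summit.BirchSwinnertonDyer.BirchSwinnertonDyer.Theorems.ThetaLayerLambdaCongruenceAtTwo
open Summit.BirchSwinnertonDyer.BirchSwinnertonDyer.Theorems.AlignedTransportAtTwoKilfordCopyCongruenceForms
open Summit.BirchSwinnertonDyer.BirchSwinnertonDyer.Theorems.AlignedTransportAtTwoKilfordCopyOfCopyAlignmentRankFree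
open Summit.BirchSwinnertonDyer.BirchSwinnertonDyer.Theorems.AlignedTransportAtTwoKilfordCopyCrossLevelTools
open Summit.BirchSwinnertonDyer.BirchSwinnertonDyer.Theorems.AlignedTransportAtTwoKilfordKernelLetterCrossLevelIhara
open Summit.BirchSwinnertonDyer.BirchSwinnertonDyer.Theorems.AlignedTransportAtTwoKilfordKernelLetterCrossLevelOnePrime
open Summit.BirchSwinnertonDyer.BirchSwinnertonDyer.Theorems.AlignedTransportAtTwoKilfordKernelLetterOfCarrierProp
open Summit.BirchSwinnertonDyer.BirchSwinnertonDyer.Theorems.AlignedTransportAtTwoOfPrintAndCopySplit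

namespace Summit.BirchSwinnertonDyer.BirchSwinnertonDyer.Theorems.AlignedTransportAtTwoKilfordKernelLetterSplitShape

/-! ## §1 The split by shape, modulo PRINT + T1⁺ + T4 + `hEq` + Ihara + MULT2 + `hKLCF` + `hRest` -/

/-- **`stub_lamLawKilford` SPLIT BY SHAPE** (module docstring): equal conductors `hEq`; one-prime unequal shapes by
`uniformize_depleted_iff_of_onePrime_of_facts`; all other unequal shapes `hRest` (with lifts and shape exclusions as extra binders).
[cite: GreenbergVatsal2000, Thm. (1.4) and §3] [cite: DarmonDiamondTaylor1995, Lemma 4.28 (a) (p. 135), §1.5 and §1.7] [cite: KilfordWiese2008, Question 1.9]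
[cite: AtkinLehner1970, §3] -/
theorem lamLawKilford_of_print_splitShape
    (hΩu : realPeriodRat_eq_unit_mul_plusPeriod_two)
    (hJ : nonempty_modularJacobianGaloisDataWithForms)
    (hT4 : ∀ (W : WeierstrassCurve ℚ) [W.IsElliptic] [W.IsGloballyMinimal] [NeZero (W.conductorNorm ℤ)],
      IsOrdinaryAt W 2 → (∀ x : ℚ, ¬ HasRationalTwoTorsionX W x) →
        ∃ D : ModularParametrizationData W (W.conductorNorm ℤ), Odd D.c)
    (hIh : ihara_periodHomology_mod_eisenstein) (hM2 : MultiplicityTwoOnStratumAtTwo)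
    (hKLCF : ∀ (N : ℕ) [NeZero N] (ι : AlgebraicClosure ℚ →+* ℂ), ∃ Dj : ModularJacobianGaloisDataWithFormsAndPairing N ι,
      KernelLetterCarrierWithFormsAtTwo N ι Dj.toModularJacobianGaloisDataWithPairing)
    (hEq : ∀ (W₁ : WeierstrassCurve ℚ) [W₁.IsElliptic] [W₁.IsGloballyMinimal]
      (W₂ : WeierstrassCurve ℚ) [W₂.IsElliptic] [W₂.IsGloballyMinimal],
      IsOrdinaryAt W₁ 2 → IsOrdinaryAt W₂ 2 →
      (∀ x : ℚ, ¬ HasRationalTwoTorsionX W₁ x) → (∀ x : ℚ, ¬ HasRationalTwoTorsionX W₂ x) →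
      ¬ IsSquare W₁.Δ → ¬ IsSquare W₂.Δ →
      (¬ ∃ (d : ℚ) (c : WeierstrassCurve.VariableChange ℚ), c • W₁.quadraticTwist d = W₂) →
      OnKilfordStratumAtTwo W₁ →
      ∀ (F : Type) [Field F] [NumberField F], Module.finrank ℚ F = 3 →
      ∀ e₁ e₂ : F, aeval e₁ (twoDivisionUCubic W₁) = 0 → aeval e₂ (twoDivisionUCubic W₂) = 0 →
      AlignedAtTwo F e₁ e₂ → AlignedAtInfinity F (twoDivisionUCubic W₁) (twoDivisionUCubic W₂) e₁ e₂ →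
      ∀ [NeZero (W₁.conductorNorm ℤ)] [NeZero (W₂.conductorNorm ℤ)]
        (f₁ : CuspForm (Gamma0 (W₁.conductorNorm ℤ)) 2), IsNewformOf W₁ f₁ →
      ∀ (f₂ : CuspForm (Gamma0 (W₂.conductorNorm ℤ)) 2), IsNewformOf W₂ f₂ →
      ∀ G₁ G₂ : IwasawaAlgebra 2, IsEvenBranchLiftAtTwo W₁ f₁ G₁ → IsEvenBranchLiftAtTwo W₂ f₂ G₂ →
      W₁.conductorNorm ℤ = W₂.conductorNorm ℤ →
        lam G₁ + ∑ ℓ ∈ (W₁.conductorNorm ℤ * W₂.conductorNorm ℤ).primeFactors.erase 2, lambdaCorrectionAtTwo W₁ ℓ =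
          lam G₂ + ∑ ℓ ∈ (W₁.conductorNorm ℤ * W₂.conductorNorm ℤ).primeFactors.erase 2, lambdaCorrectionAtTwo W₂ ℓ)
    (hRest : ∀ (W₁ : WeierstrassCurve ℚ) [W₁.IsElliptic] [W₁.IsGloballyMinimal]
      (W₂ : WeierstrassCurve ℚ) [W₂.IsElliptic] [W₂.IsGloballyMinimal],
      IsOrdinaryAt W₁ 2 → IsOrdinaryAt W₂ 2 →
      (∀ x : ℚ, ¬ HasRationalTwoTorsionX W₁ x) → (∀ x : ℚ, ¬ HasRationalTwoTorsionX W₂ x) →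
      ¬ IsSquare W₁.Δ → ¬ IsSquare W₂.Δ →
      (¬ ∃ (d : ℚ) (c : WeierstrassCurve.VariableChange ℚ), c • W₁.quadraticTwist d = W₂) →
      OnKilfordStratumAtTwo W₁ → W₁.conductorNorm ℤ ≠ W₂.conductorNorm ℤ →
      ∀ (F : Type) [Field F] [NumberField F], Module.finrank ℚ F = 3 →
      ∀ e₁ e₂ : F, aeval e₁ (twoDivisionUCubic W₁) = 0 → aeval e₂ (twoDivisionUCubic W₂) = 0 →
      AlignedAtTwo F e₁ e₂ → AlignedAtInfinity F (twoDivisionUCubic W₁) (twoDivisionUCubic W₂) e₁ e₂ →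
      ∀ [NeZero (W₁.conductorNorm ℤ)] [NeZero (W₂.conductorNorm ℤ)]
        (D₁ : ModularParametrizationData W₁ (W₁.conductorNorm ℤ)) (D₂ : ModularParametrizationData W₂ (W₂.conductorNorm ℤ)),
        Odd D₁.c → Odd D₂.c →
      ∀ (G₁ G₂ : IwasawaAlgebra 2), IsEvenBranchLiftAtTwo W₁ D₁.f G₁ → IsEvenBranchLiftAtTwo W₂ D₂.f G₂ →
      (¬ ∃ q : ℕ, q.Prime ∧ ¬ q ∣ W₁.conductorNorm ℤ ∧ W₂.conductorNorm ℤ = W₁.conductorNorm ℤ * q) →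
      (¬ ∃ q : ℕ, q.Prime ∧ ¬ q ∣ W₂.conductorNorm ℤ ∧ W₁.conductorNorm ℤ = W₂.conductorNorm ℤ * q) →
      ∀ (N' : ℕ) [NeZero N'], N' = W₁.conductorNorm ℤ * W₂.conductorNorm ℤ *
          ∏ ℓ ∈ (W₁.conductorNorm ℤ * W₂.conductorNorm ℤ).primeFactors.erase 2, ℓ ^ 2 →
      ∀ (g₁ g₂ : CuspForm (Gamma0 N') 2),
        (∀ n : ℕ, cuspCoeff g₁ n =
          if ∃ ℓ ∈ (W₁.conductorNorm ℤ * W₂.conductorNorm ℤ).primeFactors.erase 2, ℓ ∣ n then 0 else cuspCoeff D₁.f n) →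
        (∀ n : ℕ, cuspCoeff g₂ n =
          if ∃ ℓ ∈ (W₁.conductorNorm ℤ * W₂.conductorNorm ℤ).primeFactors.erase 2, ℓ ∣ n then 0 else cuspCoeff D₂.f n) →
      ∀ x ∈ periodHomology N',
        D₁.uniformize ((D₁.c : ℂ) *
            ((((∏ ℓ ∈ (W₁.conductorNorm ℤ * W₂.conductorNorm ℤ).primeFactors.erase 2, ℓ ^ 2 : ℕ) : ℂ) * x g₁) / 2)) = 0 ↔
          D₂.uniformize ((D₂.c : ℂ) *
            ((((∏ ℓ ∈ (W₁.conductorNorm ℤ * W₂.conductorNorm ℤ).primeFactors.erase 2, ℓ ^ 2 : ℕ) : ℂ) * x g₂) / 2)) = 0) :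
    ∀ (W₁ : WeierstrassCurve ℚ) [W₁.IsElliptic] [W₁.IsGloballyMinimal]
      (W₂ : WeierstrassCurve ℚ) [W₂.IsElliptic] [W₂.IsGloballyMinimal],
      IsOrdinaryAt W₁ 2 → IsOrdinaryAt W₂ 2 →
      (∀ x : ℚ, ¬ HasRationalTwoTorsionX W₁ x) → (∀ x : ℚ, ¬ HasRationalTwoTorsionX W₂ x) →
      ¬ IsSquare W₁.Δ → ¬ IsSquare W₂.Δ →
      (¬ ∃ (d : ℚ) (c : WeierstrassCurve.VariableChange ℚ), c • W₁.quadraticTwist d = W₂) →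
      OnKilfordStratumAtTwo W₁ →
      ∀ (F : Type) [Field F] [NumberField F], Module.finrank ℚ F = 3 →
      ∀ e₁ e₂ : F, aeval e₁ (twoDivisionUCubic W₁) = 0 → aeval e₂ (twoDivisionUCubic W₂) = 0 →
      AlignedAtTwo F e₁ e₂ → AlignedAtInfinity F (twoDivisionUCubic W₁) (twoDivisionUCubic W₂) e₁ e₂ →
      ∀ [NeZero (W₁.conductorNorm ℤ)] [NeZero (W₂.conductorNorm ℤ)]
        (f₁ : CuspForm (Gamma0 (W₁.conductorNorm ℤ)) 2), IsNewformOf W₁ f₁ →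
      ∀ (f₂ : CuspForm (Gamma0 (W₂.conductorNorm ℤ)) 2), IsNewformOf W₂ f₂ →
      ∀ G₁ G₂ : IwasawaAlgebra 2, IsEvenBranchLiftAtTwo W₁ f₁ G₁ → IsEvenBranchLiftAtTwo W₂ f₂ G₂ →
        lam G₁ + ∑ ℓ ∈ (W₁.conductorNorm ℤ * W₂.conductorNorm ℤ).primeFactors.erase 2, lambdaCorrectionAtTwo W₁ ℓ =
          lam G₂ + ∑ ℓ ∈ (W₁.conductorNorm ℤ * W₂.conductorNorm ℤ).primeFactors.erase 2, lambdaCorrectionAtTwo W₂ ℓ := by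
  intro W₁ _ _ W₂ _ _ hord₁ hord₂ ht₁ ht₂ hsq₁ hsq₂ htw hK F _ _ hF e₁ e₂ he₁ he₂ h2 hal _ _ f₁ hf₁ f₂ hf₂ G₁ G₂ hG₁ hG₂
  -- EQUAL conductors: the named-conjecture road (`hEq`); UNEQUAL: the depleted-level copy hypothesis
  by_cases hN : W₁.conductorNorm ℤ = W₂.conductorNorm ℤ
  · exact hEq W₁ W₂ hord₁ hord₂ ht₁ ht₂ hsq₁ hsq₂ htw hK F hF e₁ e₂ he₁ he₂ h2 hal f₁ hf₁ f₂ hf₂ G₁ G₂ hG₁ hG₂ hN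
  obtain ⟨D₁, hc₁⟩ := hT4 W₁ hord₁ ht₁
  obtain ⟨D₂, hc₂⟩ := hT4 W₂ hord₂ ht₂
  -- an embedding `ℚ̄ → ℂ`, the depleted level, the carrier instance
  let ι : AlgebraicClosure ℚ →+* ℂ :=
    (@IsAlgClosed.lift ℂ _ _ ℚ _ _ (AlgebraicClosure ℚ) _ _ (AlgebraicClosure.instAlgebra ℚ) _ _ _
      (AlgebraicClosure.isAlgebraic ℚ)).toRingHom
  have hN₁0 : W₁.conductorNorm ℤ ≠ 0 := NeZero.ne _
  have hN₂0 : W₂.conductorNorm ℤ ≠ 0 := NeZero.ne _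
  have h2N₁ : ¬ 2 ∣ W₁.conductorNorm ℤ := not_dvd_level_of_isNewformOf hf₁ hord₁.1
  have h2N₂ : ¬ 2 ∣ W₂.conductorNorm ℤ := not_dvd_level_of_isNewformOf hf₂ hord₂.1
  set M : ℕ := W₁.conductorNorm ℤ * W₂.conductorNorm ℤ with hM
  have hM0 : M ≠ 0 := mul_ne_zero hN₁0 hN₂0
  have h2M : ¬ 2 ∣ M := fun h ↦ ((Nat.Prime.dvd_mul Nat.prime_two).mp h).elim h2N₁ h2N₂
  set SS : Finset ℕ := M.primeFactors.erase 2 with hSS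
  have hSSp : ∀ ℓ ∈ SS, ℓ.Prime := fun ℓ hℓ ↦ Nat.prime_of_mem_primeFactors (Finset.mem_of_mem_erase hℓ)
  set N' : ℕ := M * ∏ ℓ ∈ SS, ℓ ^ 2 with hN'
  haveI : NeZero N' := ⟨by
    rw [hN']
    exact mul_ne_zero hM0 (Finset.prod_ne_zero_iff.mpr fun ℓ hℓ ↦ pow_ne_zero _ (hSSp ℓ hℓ).ne_zero)⟩
  obtain ⟨J'⟩ := hJ N' ι
  have hNL₁ : W₁.conductorNorm ℤ * ∏ ℓ ∈ SS, ℓ ^ 2 ∣ N' := ⟨W₂.conductorNorm ℤ, by rw [hN', hM]; ring⟩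
  have hNL₂ : W₂.conductorNorm ℤ * ∏ ℓ ∈ SS, ℓ ^ 2 ∣ N' := ⟨W₁.conductorNorm ℤ, by rw [hN', hM]; ring⟩
  have hLS : ∀ p : ℕ, p.Prime → p ∣ N' → p ∈ SS := by
    intro p hp hpN
    rw [hN'] at hpN
    rcases (Nat.Prime.dvd_mul hp).mp hpN with h | h
    · refine Finset.mem_erase.mpr ⟨?_, Nat.mem_primeFactors.mpr ⟨hp, h, hM0⟩⟩
      rintro rfl; exact h2M h
    · obtain ⟨ℓ, hℓ, hℓp⟩ := (hp.prime.dvd_finsetProd_iff _).mp h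
      rwa [(Nat.prime_dvd_prime_iff_eq hp (hSSp ℓ hℓ)).mp (hp.dvd_of_dvd_pow hℓp)]
  -- the depleted eigenforms at level `N'`
  have hint₁ : ∀ n : ℕ, ∃ z : ℤ, cuspCoeff f₁ n = z := fun n ↦ ⟨W₁.LFunction n, hf₁.2 n⟩
  have hint₂ : ∀ n : ℕ, ∃ z : ℤ, cuspCoeff f₂ n = z := fun n ↦ ⟨W₂.LFunction n, hf₂.2 n⟩
  have hTf₁ : ∀ (p : ℕ) (hp : p.Prime),
      (haveI : NeZero p := ⟨hp.ne_zero⟩; heckeT (Gamma0 (W₁.conductorNorm ℤ)) 2 p f₁) = cuspCoeff f₁ p • f₁ :=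
    fun p hp ↦ by haveI : NeZero p := ⟨hp.ne_zero⟩; exact hf₁.1.heckeT_eq_coeff_smul hp
  have hTf₂ : ∀ (p : ℕ) (hp : p.Prime),
      (haveI : NeZero p := ⟨hp.ne_zero⟩; heckeT (Gamma0 (W₂.conductorNorm ℤ)) 2 p f₂) = cuspCoeff f₂ p • f₂ :=
    fun p hp ↦ by haveI : NeZero p := ⟨hp.ne_zero⟩; exact hf₂.1.heckeT_eq_coeff_smul hp
  obtain ⟨g₁, hg₁, -, -, -, -, -, -⟩ := exists_depleted_eigenform_of_dvd f₁ hint₁ hf₁.1.2.2 hTf₁ SS hSSp N' hNL₁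
    (fun p hp hpN ↦ Or.inr (hLS p hp hpN))
  obtain ⟨g₂, hg₂, -, -, -, -, -, -⟩ := exists_depleted_eigenform_of_dvd f₂ hint₂ hf₂.1.2.2 hTf₂ SS hSSp N' hNL₂
    (fun p hp hpN ↦ Or.inr (hLS p hp hpN))
  have hfD₁ : D₁.f = f₁ := eq_of_forall_cuspCoeff_eq_gamma0 fun n ↦ by rw [D₁.isNewformOf.2 n, hf₁.2 n]
  have hfD₂ : D₂.f = f₂ := eq_of_forall_cuspCoeff_eq_gamma0 fun n ↦ by rw [D₂.isNewformOf.2 n, hf₂.2 n]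
  have hg₁D : ∀ n : ℕ, cuspCoeff g₁ n = if ∃ ℓ ∈ SS, ℓ ∣ n then 0 else cuspCoeff D₁.f n := fun n ↦ by rw [hg₁ n, hfD₁]
  have hg₂D : ∀ n : ℕ, cuspCoeff g₂ n = if ∃ ℓ ∈ SS, ℓ ∣ n then 0 else cuspCoeff D₂.f n := fun n ↦ by rw [hg₂ n, hfD₂]
  -- the research hypothesis, instantiated
  -- the depletion set: odd primes, `q ∈ SS` and `SS ∖ q ⊆ primes of the lower level` on a one-prime shape
  have hSSodd : ∀ ℓ ∈ SS, Odd ℓ := fun ℓ hℓ ↦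
    (hSSp ℓ hℓ).odd_of_ne_two (Finset.ne_of_mem_erase hℓ)
  have hSW₁ : ∀ ℓ ∈ SS, ℓ ∣ W₁.conductorNorm ℤ ∨ ℓ ∣ W₂.conductorNorm ℤ := fun ℓ hℓ ↦
    (Nat.Prime.dvd_mul (hSSp ℓ hℓ)).mp (hM ▸ (Nat.mem_primeFactors.mp (Finset.mem_of_mem_erase hℓ)).2.1)
  have hmemSS : ∀ q : ℕ, q.Prime → q ∣ M → q ∈ SS := fun q hq hqM ↦
    Finset.mem_erase.mpr ⟨fun h ↦ h2M (h ▸ hqM), Nat.mem_primeFactors.mpr ⟨hq, hqM, hM0⟩⟩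
  -- an old line at a prescribed level
  have holdLine : ∀ {L₁ : ℕ} [NeZero L₁] (q : ℕ) [NeZero q] (f : CuspForm (Gamma0 L₁) 2) (L₂ : ℕ) [NeZero L₂], L₂ = L₁ * q →
      ∃ F₁ : CuspForm (Gamma0 L₂) 2, ∀ n : ℕ, cuspCoeff F₁ n = cuspCoeff f n + (q : ℂ) * (if q ∣ n then cuspCoeff f (n / q) else 0) := by
    intro L₁ _ q _ f L₂ _ h
    subst h
    exact exists_oldLine q f
  have hkerU : ∀ x ∈ periodHomology N',
      D₁.uniformize ((D₁.c : ℂ) * ((((∏ ℓ ∈ SS, ℓ ^ 2 : ℕ) : ℂ) * x g₁) / 2)) = 0 ↔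
        D₂.uniformize ((D₂.c : ℂ) * ((((∏ ℓ ∈ SS, ℓ ^ 2 : ℕ) : ℂ) * x g₂) / 2)) = 0 := by
    by_cases hA : ∃ q : ℕ, q.Prime ∧ ¬ q ∣ W₁.conductorNorm ℤ ∧ W₂.conductorNorm ℤ = W₁.conductorNorm ℤ * q
    · -- ONE-PRIME SHAPE `N(W₂) = q·N(W₁)`: the assembled capstone (Ihara + lifts + MULT2 + KLCF)
      obtain ⟨q, hq, hqN₁, hN₂⟩ := hA
      haveI : NeZero q := ⟨hq.ne_zero⟩
      obtain ⟨F₁, hF₁⟩ := holdLine q D₁.f (W₂.conductorNorm ℤ) hN₂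
      have hqSS : q ∈ SS := hmemSS q hq (by rw [hM, hN₂, ← mul_assoc]; exact dvd_mul_left q _)
      have hSSN : ∀ ℓ ∈ SS, ℓ ≠ q → ℓ ∣ W₁.conductorNorm ℤ := by
        intro ℓ hℓ hℓq
        rcases hSW₁ ℓ hℓ with h | h
        · exact h
        · rw [hN₂] at h
          rcases (Nat.Prime.dvd_mul (hSSp ℓ hℓ)).mp h with h | h
          · exact h
          · exact absurd ((Nat.prime_dvd_prime_iff_eq (hSSp ℓ hℓ) hq).mp h) hℓq
      exact uniformize_depleted_iff_of_onePrime_of_facts hIh hΩu hM2 hKLCF W₁ W₂ hord₁ hord₂ ht₁ ht₂ hsq₁ hsq₂ hK hF he₁ he₂ h2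
        hf₁ hG₁ hf₂ hG₂ D₁ D₂ hc₁ hc₂ hq hqN₁ hN₂ SS hSSp hSSodd hqSS hSSN N' hNL₂ g₁ g₂ hg₁D hg₂D F₁ hF₁
    by_cases hB : ∃ q : ℕ, q.Prime ∧ ¬ q ∣ W₂.conductorNorm ℤ ∧ W₁.conductorNorm ℤ = W₂.conductorNorm ℤ * q
    · -- the mirror shape `N(W₁) = q·N(W₂)`: the same capstone with the roles of the two curves exchanged
      obtain ⟨q, hq, hqN₂, hN₁⟩ := hB
      haveI : NeZero q := ⟨hq.ne_zero⟩
      obtain ⟨F₂, hF₂⟩ := holdLine q D₂.f (W₁.conductorNorm ℤ) hN₁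
      have hqSS : q ∈ SS := hmemSS q hq (by rw [hM, hN₁, mul_assoc, mul_comm q, ← mul_assoc]; exact dvd_mul_left q _)
      have hSSN : ∀ ℓ ∈ SS, ℓ ≠ q → ℓ ∣ W₂.conductorNorm ℤ := by
        intro ℓ hℓ hℓq
        rcases hSW₁ ℓ hℓ with h | h
        · rw [hN₁] at h
          rcases (Nat.Prime.dvd_mul (hSSp ℓ hℓ)).mp h with h | h
          · exact h
          · exact absurd ((Nat.prime_dvd_prime_iff_eq (hSSp ℓ hℓ) hq).mp h) hℓq
        · exact h
      have hK₂ : OnKilfordStratumAtTwo W₂ :=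
        (Summit.BirchSwinnertonDyer.BirchSwinnertonDyer.Theorems.AlignedTransportAtTwoKilfordStratumShared.onKilfordStratumAtTwo_iff_of_sharedCubicField
          W₁ W₂ hF ht₁ ht₂ he₁ he₂).mp hK
      have h2' : AlignedAtTwo F e₂ e₁ := fun v hv ↦ (h2 v hv).symm
      intro x hx
      exact (uniformize_depleted_iff_of_onePrime_of_facts hIh hΩu hM2 hKLCF W₂ W₁ hord₂ hord₁ ht₂ ht₁ hsq₂ hsq₁ hK₂ hF he₂ he₁ h2'
        hf₂ hG₂ hf₁ hG₁ D₂ D₁ hc₂ hc₁ hq hqN₂ hN₁ SS hSSp hSSodd hqSS hSSN N' hNL₁ g₂ g₁ hg₂D hg₁D F₂ hF₂ x hx).symm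
    -- every other unequal-conductor shape: the inline hypothesis (with the lifts in hand)
    exact hRest W₁ W₂ hord₁ hord₂ ht₁ ht₂ hsq₁ hsq₂ htw hK hN F hF e₁ e₂ he₁ he₂ h2 hal D₁ D₂ hc₁ hc₂ G₁ G₂
      (by rw [hfD₁]; exact hG₁) (by rw [hfD₂]; exact hG₂) hA hB N' hN' g₁ g₂ hg₁D hg₂D
  exact lamLaw_of_forms_of_ker_iff hΩu W₁ W₂ hord₁ hord₂ ht₁ ht₂ hsq₂ hF he₁ he₂ hal hf₁ hf₂ hG₁ hG₂ D₁ D₂ hc₁ hc₂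
    ι N' hN' J' g₁ g₂ hg₁ hg₂ hkerU



/-! ## §2 T4 and `hEq` discharged: `stub_lamLawKilford` from PRINT⁴ + MULT2 + `hKLCF` + `hRest` -/

/-- **`stub_lamLawKilford` from PRINT⁴ {period unit, modularity, T1⁺, Ihara} + `F1Sign2.MultiplicityTwoOnStratumAtTwo` + the forms-widened kernel-letter carrier
`hKLCF` (∃-form over the joint datum) + `hRest` (non-one-prime unequal shapes, inline, with lifts).** T4 by `exists_datum_odd_maninConstant`; `hEq` by
`…OfCarrierProp.lamLawKilford_eq_of_multTwo_of_kernelLetterCarrierAtTwo` (the plain carrier from `hKLCF` by `KernelLetterCarrier.kernelLetterCarrierAtTwo_of_withForms`).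
[cite: GreenbergVatsal2000, Thm. (1.4)] [cite: AbbesUllmo1996, Thm. A] [cite: KilfordWiese2008, Question 1.9] [cite: DarmonDiamondTaylor1995, Lemma 4.28 (a) (p. 135)] -/
theorem lamLawKilford_of_facts_splitShape
    (hΩu : realPeriodRat_eq_unit_mul_plusPeriod_two) (hmod : exists_isNewformOf) (hJ : nonempty_modularJacobianGaloisDataWithForms)
    (hIh : ihara_periodHomology_mod_eisenstein) (hM2 : MultiplicityTwoOnStratumAtTwo)
    (hKLCF : ∀ (N : ℕ) [NeZero N] (ι : AlgebraicClosure ℚ →+* ℂ), ∃ Dj : ModularJacobianGaloisDataWithFormsAndPairing N ι,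
      KernelLetterCarrierWithFormsAtTwo N ι Dj.toModularJacobianGaloisDataWithPairing)
    (hRest : ∀ (W₁ : WeierstrassCurve ℚ) [W₁.IsElliptic] [W₁.IsGloballyMinimal]
      (W₂ : WeierstrassCurve ℚ) [W₂.IsElliptic] [W₂.IsGloballyMinimal],
      IsOrdinaryAt W₁ 2 → IsOrdinaryAt W₂ 2 →
      (∀ x : ℚ, ¬ HasRationalTwoTorsionX W₁ x) → (∀ x : ℚ, ¬ HasRationalTwoTorsionX W₂ x) →
      ¬ IsSquare W₁.Δ → ¬ IsSquare W₂.Δ →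
      (¬ ∃ (d : ℚ) (c : WeierstrassCurve.VariableChange ℚ), c • W₁.quadraticTwist d = W₂) →
      OnKilfordStratumAtTwo W₁ → W₁.conductorNorm ℤ ≠ W₂.conductorNorm ℤ →
      ∀ (F : Type) [Field F] [NumberField F], Module.finrank ℚ F = 3 →
      ∀ e₁ e₂ : F, aeval e₁ (twoDivisionUCubic W₁) = 0 → aeval e₂ (twoDivisionUCubic W₂) = 0 →
      AlignedAtTwo F e₁ e₂ → AlignedAtInfinity F (twoDivisionUCubic W₁) (twoDivisionUCubic W₂) e₁ e₂ →
      ∀ [NeZero (W₁.conductorNorm ℤ)] [NeZero (W₂.conductorNorm ℤ)]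
        (D₁ : ModularParametrizationData W₁ (W₁.conductorNorm ℤ)) (D₂ : ModularParametrizationData W₂ (W₂.conductorNorm ℤ)),
        Odd D₁.c → Odd D₂.c →
      ∀ (G₁ G₂ : IwasawaAlgebra 2), IsEvenBranchLiftAtTwo W₁ D₁.f G₁ → IsEvenBranchLiftAtTwo W₂ D₂.f G₂ →
      (¬ ∃ q : ℕ, q.Prime ∧ ¬ q ∣ W₁.conductorNorm ℤ ∧ W₂.conductorNorm ℤ = W₁.conductorNorm ℤ * q) →
      (¬ ∃ q : ℕ, q.Prime ∧ ¬ q ∣ W₂.conductorNorm ℤ ∧ W₁.conductorNorm ℤ = W₂.conductorNorm ℤ * q) →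
      ∀ (N' : ℕ) [NeZero N'], N' = W₁.conductorNorm ℤ * W₂.conductorNorm ℤ *
          ∏ ℓ ∈ (W₁.conductorNorm ℤ * W₂.conductorNorm ℤ).primeFactors.erase 2, ℓ ^ 2 →
      ∀ (g₁ g₂ : CuspForm (Gamma0 N') 2),
        (∀ n : ℕ, cuspCoeff g₁ n =
          if ∃ ℓ ∈ (W₁.conductorNorm ℤ * W₂.conductorNorm ℤ).primeFactors.erase 2, ℓ ∣ n then 0 else cuspCoeff D₁.f n) →
        (∀ n : ℕ, cuspCoeff g₂ n =
          if ∃ ℓ ∈ (W₁.conductorNorm ℤ * W₂.conductorNorm ℤ).primeFactors.erase 2, ℓ ∣ n then 0 else cuspCoeff D₂.f n) →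
      ∀ x ∈ periodHomology N',
        D₁.uniformize ((D₁.c : ℂ) *
            ((((∏ ℓ ∈ (W₁.conductorNorm ℤ * W₂.conductorNorm ℤ).primeFactors.erase 2, ℓ ^ 2 : ℕ) : ℂ) * x g₁) / 2)) = 0 ↔
          D₂.uniformize ((D₂.c : ℂ) *
            ((((∏ ℓ ∈ (W₁.conductorNorm ℤ * W₂.conductorNorm ℤ).primeFactors.erase 2, ℓ ^ 2 : ℕ) : ℂ) * x g₂) / 2)) = 0) :
    ∀ (W₁ : WeierstrassCurve ℚ) [W₁.IsElliptic] [W₁.IsGloballyMinimal]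
      (W₂ : WeierstrassCurve ℚ) [W₂.IsElliptic] [W₂.IsGloballyMinimal],
      IsOrdinaryAt W₁ 2 → IsOrdinaryAt W₂ 2 →
      (∀ x : ℚ, ¬ HasRationalTwoTorsionX W₁ x) → (∀ x : ℚ, ¬ HasRationalTwoTorsionX W₂ x) →
      ¬ IsSquare W₁.Δ → ¬ IsSquare W₂.Δ →
      (¬ ∃ (d : ℚ) (c : WeierstrassCurve.VariableChange ℚ), c • W₁.quadraticTwist d = W₂) →
      OnKilfordStratumAtTwo W₁ →
      ∀ (F : Type) [Field F] [NumberField F], Module.finrank ℚ F = 3 →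
      ∀ e₁ e₂ : F, aeval e₁ (twoDivisionUCubic W₁) = 0 → aeval e₂ (twoDivisionUCubic W₂) = 0 →
      AlignedAtTwo F e₁ e₂ → AlignedAtInfinity F (twoDivisionUCubic W₁) (twoDivisionUCubic W₂) e₁ e₂ →
      ∀ [NeZero (W₁.conductorNorm ℤ)] [NeZero (W₂.conductorNorm ℤ)]
        (f₁ : CuspForm (Gamma0 (W₁.conductorNorm ℤ)) 2), IsNewformOf W₁ f₁ →
      ∀ (f₂ : CuspForm (Gamma0 (W₂.conductorNorm ℤ)) 2), IsNewformOf W₂ f₂ →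
      ∀ G₁ G₂ : IwasawaAlgebra 2, IsEvenBranchLiftAtTwo W₁ f₁ G₁ → IsEvenBranchLiftAtTwo W₂ f₂ G₂ →
        lam G₁ + ∑ ℓ ∈ (W₁.conductorNorm ℤ * W₂.conductorNorm ℤ).primeFactors.erase 2, lambdaCorrectionAtTwo W₁ ℓ =
          lam G₂ + ∑ ℓ ∈ (W₁.conductorNorm ℤ * W₂.conductorNorm ℤ).primeFactors.erase 2, lambdaCorrectionAtTwo W₂ ℓ := by
  exact lamLawKilford_of_print_splitShape hΩu hJ
    (fun W _ _ _ hord ht ↦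
      Summit.BirchSwinnertonDyer.BirchSwinnertonDyer.Theorems.AlignedTransportAtTwoDeltaPosOddManin.exists_datum_odd_maninConstant hmod
        integral_neronScaling_of_isGloballyMinimal_holds hΩu W hord ht)
    hIh hM2 hKLCF
    (lamLawKilford_eq_of_multTwo_of_kernelLetterCarrierAtTwo hΩu hmod hM2 fun N _ ι ↦ by
      obtain ⟨Dj, h⟩ := hKLCF N ι
      exact ⟨Dj.toModularJacobianGaloisDataWithPairing, KernelLetterCarrier.kernelLetterCarrierAtTwo_of_withForms h⟩)
    hRest

end Summit.BirchSwinnertonDyer.BirchSwinnertonDyer.Theorems.AlignedTransportAtTwoKilfordKernelLetterSplitShape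

end
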